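import Literature.Computability.Cryptography.QuantumTuringMachineHeadCentred
import Literature.Computability.Cryptography.PolyTimeComputableRealsSqrt
import Mathlib.Analysis.InnerProductSpace.GramMatrix
import HarnessLib

/-!
# Entries of the head-centred step unitary: orthogonal projections over conj-closed subfields, and polynomial-time computable gates

Sequel of `QuantumTuringMachineHeadCentred.lean` (the head-centred simulating unitary
`hcStep = U_E · U_S · U_W` of a quantum Turing machine in the tree's model; Nishimura–Ozawa 2002,
Thm. 4.3 with Bernstein–Vazirani 1997, Lemma 5.5). The circuit side of `BQPQTM ⊆ BQP` compiles the
simulating gates into a fixed universal gate set, which in the bit model requires their entries to be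
polynomial-time computable numbers (Nishimura–Ozawa 2002, §3–§4: gates of `𝒢_PC`, amplitudes in
`PC`; Bernstein–Vazirani 1997, §6: "we restrict … to amplitudes … computable to within `2⁻ⁿ` in time
polynomial in `n`", and this class is closed under the algebraic operations used). This file proves
that the gates of the head-centred construction inherit this from the machine:

* `EntriesIn K A` (all entries in a subfield `K ⊆ ℂ`) and its closure properties, in particular
  under the swap-unitary formula (`EntriesIn.swapUnitary`) — `U_W` has entries that are integer
  polynomials in the amplitudes and their conjugates (`entriesIn_uW`);
* **`entriesIn_starProjection_span`** — the orthogonal projection onto the span of finitely many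
  vectors with entries in a conj-closed subfield `K` has entries in `K` (linearly independent
  spanning subfamily, Gram matrix `Vᴴ V` invertible over `K`, `P = V (VᴴV)⁻¹ Vᴴ` identified with
  Mathlib's `Submodule.starProjection` by the characterisation of orthogonal projections); hence
  Bernstein–Vazirani's direction projections `P_L`, `P_R` and the erasure gate `U_E` have entries in
  `K` (`entriesIn_dirProj`, `entriesIn_uE`), as do `U_S` (0/1), `hcStep`, and the one-symbol step
  matrix `A = δ_L + δ_R` (`entriesIn_localSum`, `entriesIn_hcStep₁`);
* **`polyTimeComputableSubfield`** — the tree's `polyTimeComputableComplex` (Q8,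
  `IsPolyTimeComputableComplex`; Ko 1991, Bernstein–Vazirani 1997 §6) IS a conj-closed subfield of
  `ℂ` (field operations from `PolyTimeComputableReals.lean` / `PolyTimeComputableRealsSqrt.lean`
  plus `IsPolyTimeComputableComplex.inv` here);
* `uW_polyTime`, `uE_polyTime`, `localSum_polyTime`, `hcUnitary_polyTime` — **for `M` with
  `M.amplitudes ⊆ polyTimeComputableComplex` (the hypothesis of `BQPQTM`), every simulating gate has
  polynomial-time computable entries.**

All statements are proved; no named facts.

## References

* H. Nishimura, M. Ozawa, Theoret. Comput. Sci. 276 (2002) 147–181 = arXiv:quant-ph/9906095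
  [NishimuraOzawa2002], §3 (`PC`, `𝒢_PC`), §4 and Thm. 4.3.
* E. Bernstein, U. Vazirani, SIAM J. Comput. 26 (1997) 1411–1473 [BernsteinVazirani1997SICOMP],
  Lemma 5.5 (change of basis `C_L ⊕ C_R`), §6 (efficiently computable amplitudes), Def. 3.2
  [BernsteinVazirani1997].
* K.-I. Ko, *Complexity Theory of Real Functions*, Birkhäuser 1991 [Ko1991], §2.1 (polynomial-time
  computable reals; closure under field operations).
-/

noncomputable section

namespace Literature.Computability.Cryptography

open Turing Matrix
open scoped BigOperators ComplexConjugate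

namespace QTM

/-! ### Matrices with entries in a subfield -/

section entries

variable (K : Subfield ℂ)

/-- `EntriesIn K A`: every entry of the matrix `A` lies in the subfield `K ⊆ ℂ`. [folklore] -/
def EntriesIn {m n : Type*} (A : Matrix m n ℂ) : Prop := ∀ i j, A i j ∈ K

variable {K}

/-- Sums of `K`-matrices are `K`-matrices. [folklore] -/
theorem EntriesIn.add {m n : Type*} {A B : Matrix m n ℂ} (hA : EntriesIn K A) (hB : EntriesIn K B) :
    EntriesIn K (A + B) := fun i j => K.add_mem (hA i j) (hB i j)

/-- Differences of `K`-matrices are `K`-matrices. [folklore] -/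
theorem EntriesIn.sub {m n : Type*} {A B : Matrix m n ℂ} (hA : EntriesIn K A) (hB : EntriesIn K B) :
    EntriesIn K (A - B) := fun i j => K.sub_mem (hA i j) (hB i j)

/-- Products of `K`-matrices are `K`-matrices. [folklore] -/
theorem EntriesIn.mul {m n o : Type*} [Fintype n] {A : Matrix m n ℂ} {B : Matrix n o ℂ}
    (hA : EntriesIn K A) (hB : EntriesIn K B) : EntriesIn K (A * B) := fun i j => by
  rw [mul_apply]
  exact K.sum_mem fun k _ => K.mul_mem (hA i k) (hB k j)

/-- The identity is a `K`-matrix. [folklore] -/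
theorem entriesIn_one {n : Type*} [DecidableEq n] : EntriesIn K (1 : Matrix n n ℂ) := fun i j => by
  rw [one_apply]
  split_ifs
  · exact K.one_mem
  · exact K.zero_mem

/-- Adjoints of `K`-matrices are `K`-matrices when `K` is closed under complex conjugation. [folklore] -/
theorem EntriesIn.conjTranspose (hK : ∀ z ∈ K, conj z ∈ K) {m n : Type*} {A : Matrix m n ℂ}
    (hA : EntriesIn K A) : EntriesIn K Aᴴ := fun i j => hK _ (hA j i)

/-- The swap unitary `Θ + Θᴴ + (1 - ΘᴴΘ - ΘΘᴴ)` of a `K`-matrix is a `K`-matrix (`K` conj-closed): the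
point of the explicit formula for Nishimura–Ozawa's gate `G₁`. [folklore] -/
theorem EntriesIn.swapUnitary (hK : ∀ z ∈ K, conj z ∈ K) {n : Type*} [Fintype n] [DecidableEq n]
    {Θ : Matrix n n ℂ} (hΘ : EntriesIn K Θ) : EntriesIn K (swapUnitary Θ) :=
  (hΘ.add (hΘ.conjTranspose hK)).add
    ((entriesIn_one.sub ((hΘ.conjTranspose hK).mul hΘ)).sub (hΘ.mul (hΘ.conjTranspose hK)))

/-- A placed `K`-matrix is a `K`-matrix (its entries are entries of `u` or `0`). [folklore] -/
theorem EntriesIn.liftMat {X A B : Type*} [Fintype X] [DecidableEq X] [Fintype A] [DecidableEq A]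
    [Fintype B] [DecidableEq B] (π : X ≃ A × B) {u : Matrix A A ℂ} (hu : EntriesIn K u) :
    EntriesIn K (liftMat π u) := fun x y => by
  rw [liftMat_apply]
  split_ifs
  · exact hu _ _
  · exact K.zero_mem

/-! ### Orthogonal projections onto spans of vectors with entries in a `conj`-closed subfield -/

/-- **Orthogonal projections onto spans of `K`-vectors are `K`-matrices** (`K ⊆ ℂ` a subfield closed
under complex conjugation). Proof: choose a linearly independent spanning subfamily `(v_k)`
(`exists_linearIndependent'`); its Gram matrix `G = Vᴴ V` has entries in `K` and is invertible
(`Matrix.det_gram_ne_zero_iff_linearIndependent`), with inverse over `K` (`Matrix` inverse inside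
`Matrix κ κ K`); `P' = V G⁻¹ Vᴴ` has entries in `K`, maps into the span and satisfies
`Vᴴ (w - P' w) = 0`, i.e. `w - P' w ⊥ span`, so `P'` IS the orthogonal projection
(`Submodule.eq_starProjection_of_mem_of_inner_eq_zero`). This is what makes Bernstein–Vazirani's
change of basis to `C_L ⊕ C_R` (Lemma 5.5) available with amplitudes in the same number class
(BV 1997, §6: restricting to efficiently computable amplitudes loses nothing). [folklore] -/
theorem entriesIn_starProjection_span (hK : ∀ z ∈ K, conj z ∈ K) {ι n : Type} [Fintype ι]
    [Fintype n] [DecidableEq n] (v : ι → n → ℂ) (hv : ∀ i k, v i k ∈ K) :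
    EntriesIn K ((Matrix.toEuclideanCLM (n := n) (𝕜 := ℂ)).symm
      (Submodule.span ℂ (Set.range fun i => (WithLp.toLp 2 (v i) : EuclideanSpace ℂ n))).starProjection) := by
  classical
  -- a linearly independent spanning subfamily
  obtain ⟨κ, a, ha, hspan, hli⟩ :=
    exists_linearIndependent' (K := ℂ) (fun i => (WithLp.toLp 2 (v i) : EuclideanSpace ℂ n))
  haveI : Fintype κ := Fintype.ofInjective a ha
  set u : κ → EuclideanSpace ℂ n := fun k => WithLp.toLp 2 (v (a k)) with hu
  set S : Submodule ℂ (EuclideanSpace ℂ n) :=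
    Submodule.span ℂ (Set.range fun i => (WithLp.toLp 2 (v i) : EuclideanSpace ℂ n)) with hS
  have hspan' : Submodule.span ℂ (Set.range u) = S := hspan
  -- the column matrix and the Gram matrix
  set V : Matrix n κ ℂ := Matrix.of fun m k => v (a k) m with hV
  have hVK : EntriesIn K V := fun m k => hv _ _
  have hinner : ∀ (k : κ) (y : n → ℂ),
      @inner ℂ _ _ (u k) (WithLp.toLp 2 y : EuclideanSpace ℂ n) = (Vᴴ *ᵥ y) k := by
    intro k y
    rw [hu, EuclideanSpace.inner_toLp_toLp]
    simp only [mulVec, dotProduct, conjTranspose_apply, Pi.star_apply, RCLike.star_def, hV, of_apply]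
    exact Finset.sum_congr rfl fun m _ => mul_comm _ _
  have hG : Matrix.gram ℂ u = Vᴴ * V := by
    ext k l
    rw [Matrix.gram_apply, show u l = WithLp.toLp 2 (fun m => V m l) from rfl, hinner, mul_apply]
    rfl
  have hdet : (Vᴴ * V).det ≠ 0 := by
    rw [← hG]
    exact (Matrix.det_gram_ne_zero_iff_linearIndependent).2 hli
  have hGK : EntriesIn K (Vᴴ * V) := (hVK.conjTranspose hK).mul hVK
  -- the Gram matrix over `K` and its inverse
  set GK : Matrix κ κ K := Matrix.of fun k l => ⟨(Vᴴ * V) k l, hGK k l⟩ with hGKdef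
  have hmap : GK.map K.subtype = Vᴴ * V := by
    ext k l
    rfl
  have hdetK : GK.det ≠ 0 := by
    intro h0
    apply hdet
    rw [← hmap, ← RingHom.mapMatrix_apply, ← RingHom.map_det, h0, map_zero]
  have hdetU : IsUnit GK.det := isUnit_iff_ne_zero.2 hdetK
  set Binv : Matrix κ κ ℂ := (GK⁻¹).map K.subtype with hBinv
  have hBK : EntriesIn K Binv := fun k l => by
    rw [hBinv, map_apply]
    exact (GK⁻¹ k l).prop
  have hGB : Vᴴ * V * Binv = 1 := by
    rw [← hmap, hBinv, ← Matrix.map_mul, Matrix.mul_nonsing_inv _ hdetU,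
      Matrix.map_one _ (map_zero _) (map_one _)]
  -- the explicit projection
  set P' : Matrix n n ℂ := V * Binv * Vᴴ with hP'
  have hP'K : EntriesIn K P' := (hVK.mul hBK).mul (hVK.conjTranspose hK)
  -- `Vᴴ (w - P' w) = 0`
  have hann : ∀ w : n → ℂ, Vᴴ *ᵥ (w - P' *ᵥ w) = 0 := by
    intro w
    rw [mulVec_sub, hP', mulVec_mulVec, show Vᴴ * (V * Binv * Vᴴ) = Vᴴ by
      rw [← Matrix.mul_assoc, ← Matrix.mul_assoc, hGB, Matrix.one_mul], sub_self]
  -- `P' w ∈ S`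
  have hmemS : ∀ w : n → ℂ, (WithLp.toLp 2 (P' *ᵥ w) : EuclideanSpace ℂ n) ∈ S := by
    intro w
    have hlin : ∀ c : κ → ℂ, (WithLp.toLp 2 (V *ᵥ c) : EuclideanSpace ℂ n) = ∑ k, c k • u k := by
      intro c
      apply WithLp.ofLp_injective 2
      rw [WithLp.ofLp_toLp, WithLp.ofLp_sum]
      ext m
      simp only [mulVec, dotProduct, hV, of_apply, Finset.sum_apply, WithLp.ofLp_smul, hu,
        Pi.smul_apply, smul_eq_mul]
      exact Finset.sum_congr rfl fun k _ => mul_comm _ _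
    rw [hP', ← mulVec_mulVec, ← mulVec_mulVec, hlin, ← hspan']
    exact Submodule.sum_mem _ fun k _ => Submodule.smul_mem _ _ (Submodule.subset_span ⟨k, rfl⟩)
  -- orthogonality of `w - P' w` to `S`
  have horth : ∀ (w : EuclideanSpace ℂ n), ∀ s ∈ S,
      @inner ℂ _ _ (w - WithLp.toLp 2 (P' *ᵥ WithLp.ofLp w)) s = 0 := by
    intro w s hs
    rw [← hspan'] at hs
    rw [inner_eq_zero_symm]
    have hz : w - WithLp.toLp 2 (P' *ᵥ WithLp.ofLp w) =
        WithLp.toLp 2 (WithLp.ofLp w - P' *ᵥ WithLp.ofLp w) := by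
      rw [WithLp.toLp_sub, WithLp.toLp_ofLp]
    rw [hz]
    induction hs using Submodule.span_induction with
    | mem x hx =>
      obtain ⟨k, rfl⟩ := hx
      rw [hinner, hann]
      rfl
    | zero => exact inner_zero_left _
    | add x y _ _ hx hy => rw [inner_add_left, hx, hy, add_zero]
    | smul c x _ hx => rw [inner_smul_left, hx, mul_zero]
  -- identification with the orthogonal projection
  have key : S.starProjection = Matrix.toEuclideanCLM (n := n) (𝕜 := ℂ) P' := by
    ext1 w
    rw [show (Matrix.toEuclideanCLM (n := n) (𝕜 := ℂ) P') w = WithLp.toLp 2 (P' *ᵥ WithLp.ofLp w) by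
      rw [← Matrix.toEuclideanCLM_toLp, WithLp.toLp_ofLp]]
    exact Submodule.eq_starProjection_of_mem_of_inner_eq_zero (hmemS _) (horth w)
  rw [key, StarAlgEquiv.symm_apply_apply]
  exact hP'K

end entries

/-! ### Entries of `U_W`, `U_E`, `A` -/

section machine

variable (M : QTM) {K : Subfield ℂ}

/-- `Θ_W` is a `K`-matrix when the amplitudes lie in `K` (its entries are amplitudes or `0`). [folklore] -/
theorem entriesIn_thetaW (hδ : ∀ p a q b d, M.δ p a q b d ∈ K) : EntriesIn K M.thetaW := fun x y => by
  rw [thetaW_apply]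
  split_ifs
  · exact hδ _ _ _ _ _
  · exact K.zero_mem

/-- **`U_W` has entries in any conj-closed subfield containing the amplitudes** (integer polynomials in `δ`, `conj δ`). [cite: NishimuraOzawa2002, Thm. 4.3 (proof, gate G₁)] -/
theorem entriesIn_uW (hK : ∀ z ∈ K, conj z ∈ K) (hδ : ∀ p a q b d, M.δ p a q b d ∈ K) :
    EntriesIn K M.uW :=
  (M.entriesIn_thetaW hδ).swapUnitary hK

/-- The direction projections `P_L`, `P_R` have entries in any conj-closed subfield containing the amplitudes. [cite: BernsteinVazirani1997SICOMP, Lemma 5.5] -/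
theorem entriesIn_dirProj (hK : ∀ z ∈ K, conj z ∈ K) (hδ : ∀ p a q b d, M.δ p a q b d ∈ K)
    (e : Bool) : EntriesIn K (M.dirProj e) :=
  entriesIn_starProjection_span hK (fun x : M.Λ × M.Γ × M.Γ => M.resVec x.1 x.2.1 x.2.2 e)
    fun _ _ => hδ _ _ _ _ _

/-- `Θ_E` is a `K`-matrix (entries of `P_L`, `P_R` or `0`). [folklore] -/
theorem entriesIn_thetaE (hK : ∀ z ∈ K, conj z ∈ K) (hδ : ∀ p a q b d, M.δ p a q b d ∈ K) :
    EntriesIn K M.thetaE := fun x y => by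
  rw [thetaE_apply]
  split_ifs
  · exact M.entriesIn_dirProj hK hδ _ _ _
  · exact K.zero_mem

/-- **`U_E` has entries in any conj-closed subfield containing the amplitudes** (rational functions of `δ`, `conj δ`). [cite: BernsteinVazirani1997SICOMP, Lemma 5.5] -/
theorem entriesIn_uE (hK : ∀ z ∈ K, conj z ∈ K) (hδ : ∀ p a q b d, M.δ p a q b d ∈ K) :
    EntriesIn K M.uE :=
  (M.entriesIn_thetaE hK hδ).swapUnitary hK

/-- The one-symbol step matrix `A = δ_L + δ_R` has entries in any subfield containing the amplitudes. [folklore] -/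
theorem entriesIn_localSum (hδ : ∀ p a q b d, M.δ p a q b d ∈ K) : EntriesIn K M.localSum :=
  fun q' q => by
    rw [localSum_apply]
    exact K.sum_mem fun b _ => K.add_mem (hδ _ _ _ _ _) (hδ _ _ _ _ _)

/-- `U_S` is a 0/1 matrix. [folklore] -/
theorem entriesIn_uS (N : ℕ) [NeZero N] : EntriesIn K (M.uS N) := fun a b => by
  rw [uS_apply]
  split_ifs
  · exact K.one_mem
  · exact K.zero_mem

/-- The head-centred step operator has entries in any conj-closed subfield containing the amplitudes. [folklore] -/
theorem entriesIn_hcStep (hK : ∀ z ∈ K, conj z ∈ K) (hδ : ∀ p a q b d, M.δ p a q b d ∈ K) (N : ℕ)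
    [NeZero N] : EntriesIn K (M.hcStep N) :=
  ((EntriesIn.liftMat _ (M.entriesIn_uE hK hδ)).mul (M.entriesIn_uS N)).mul
    (EntriesIn.liftMat _ (M.entriesIn_uW hK hδ))

/-- The one-symbol step operator has entries in any subfield containing the amplitudes. [folklore] -/
theorem entriesIn_hcStep₁ (hδ : ∀ p a q b d, M.δ p a q b d ∈ K) (N : ℕ) [NeZero N] :
    EntriesIn K (M.hcStep₁ N) :=
  EntriesIn.liftMat _ (M.entriesIn_localSum hδ)

end machine

/-! ### The subfield of polynomial-time computable complex numbers -/

section polytime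

/-- `C̃` (complex numbers with polynomial-time computable real and imaginary parts, Bernstein–Vazirani
1997, Def. 3.2 / §6; Ko 1991) is closed under inverses: `z⁻¹ = conj z / |z|²` with
`IsPolyTimeComputableReal.div` (`PolyTimeComputableRealsSqrt.lean`). [cite: Ko1991, §2.1] -/
theorem _root_.Literature.Computability.Cryptography.IsPolyTimeComputableComplex.inv {z : ℂ}
    (hz : IsPolyTimeComputableComplex z) : IsPolyTimeComputableComplex z⁻¹ := by
  have hn : IsPolyTimeComputableReal (Complex.normSq z) := by
    rw [Complex.normSq_apply]
    exact (hz.1.mul hz.1).add (hz.2.mul hz.2)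
  refine ⟨?_, ?_⟩
  · rw [Complex.inv_re]
    exact hz.1.div hn
  · rw [Complex.inv_im]
    exact hz.2.neg.div hn

/-- **The polynomial-time computable complex numbers form a subfield of `ℂ`** (carrier
`polyTimeComputableComplex`; ring operations from `PolyTimeComputableReals*.lean`, inverses from
`IsPolyTimeComputableComplex.inv`), closed under complex conjugation
(`conj_mem_polyTimeComputableSubfield`). Ko 1991, §2 (the polynomial-time computable reals form a
real closed field); Bernstein–Vazirani 1997, §6. [cite: Ko1991, §2.1] -/
def polyTimeComputableSubfield : Subfield ℂ where
  carrier := polyTimeComputableComplex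
  mul_mem' ha hb := IsPolyTimeComputableComplex.mul ha hb
  one_mem' := by
    have := IsPolyTimeComputableComplex.ofReal (IsPolyTimeComputableReal.natCast 1)
    simpa using this
  add_mem' ha hb := IsPolyTimeComputableComplex.add ha hb
  zero_mem' := by
    have := IsPolyTimeComputableComplex.ofReal (IsPolyTimeComputableReal.natCast 0)
    simpa using this
  neg_mem' {z} hz := by
    have := IsPolyTimeComputableComplex.sub (IsPolyTimeComputableComplex.ofReal
      (IsPolyTimeComputableReal.natCast 0)) hz
    simpa using this
  inv_mem' z hz := IsPolyTimeComputableComplex.inv hz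

/-- Membership in the subfield is membership in `polyTimeComputableComplex` (definitional). [folklore] -/
@[simp] theorem mem_polyTimeComputableSubfield (z : ℂ) :
    z ∈ polyTimeComputableSubfield ↔ z ∈ polyTimeComputableComplex := Iff.rfl

/-- The subfield of polynomial-time computable numbers is closed under complex conjugation. [cite: BernsteinVazirani1997, Def. 3.2] -/
theorem conj_mem_polyTimeComputableSubfield (z : ℂ) (hz : z ∈ polyTimeComputableSubfield) :
    conj z ∈ polyTimeComputableSubfield :=
  IsPolyTimeComputableComplex.conj hz

variable (M : QTM)

/-- Every transition amplitude lies in any set containing `M.amplitudes`. [folklore] -/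
theorem delta_mem_of_amplitudes_subset {S : Set ℂ} (h : M.amplitudes ⊆ S) (p : M.Λ) (a : M.Γ)
    (q : M.Λ) (b : M.Γ) (d : Dir) : M.δ p a q b d ∈ S :=
  h ⟨p, a, q, b, d, rfl⟩

/-- **For a machine with polynomial-time computable amplitudes, `U_W` has polynomial-time computable
entries** (what gate compilation needs of the simulating gates: Nishimura–Ozawa 2002, §4, `𝒢_PC`;
Bernstein–Vazirani 1997, §6). [cite: NishimuraOzawa2002, §4] -/
theorem uW_polyTime (h : M.amplitudes ⊆ polyTimeComputableComplex) (x y : M.Loc) :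
    M.uW x y ∈ polyTimeComputableComplex :=
  M.entriesIn_uW (K := polyTimeComputableSubfield) conj_mem_polyTimeComputableSubfield
    (M.delta_mem_of_amplitudes_subset h) x y

/-- **For a machine with polynomial-time computable amplitudes, `U_E` has polynomial-time computable
entries** (via `entriesIn_starProjection_span`). [cite: NishimuraOzawa2002, §4] -/
theorem uE_polyTime (h : M.amplitudes ⊆ polyTimeComputableComplex) (x y : M.Er) :
    M.uE x y ∈ polyTimeComputableComplex :=
  M.entriesIn_uE (K := polyTimeComputableSubfield) conj_mem_polyTimeComputableSubfield
    (M.delta_mem_of_amplitudes_subset h) x y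

/-- For a machine with polynomial-time computable amplitudes, `A = δ_L + δ_R` has polynomial-time computable entries. [folklore] -/
theorem localSum_polyTime (h : M.amplitudes ⊆ polyTimeComputableComplex) (q' q : M.Λ) :
    M.localSum q' q ∈ polyTimeComputableComplex :=
  M.entriesIn_localSum (K := polyTimeComputableSubfield) (M.delta_mem_of_amplitudes_subset h) q' q

/-- For a machine with polynomial-time computable amplitudes the whole head-centred step unitary has
polynomial-time computable entries. [cite: NishimuraOzawa2002, §4] -/
theorem hcUnitary_polyTime (h : M.amplitudes ⊆ polyTimeComputableComplex) (N : ℕ) [NeZero N]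
    (a b : M.HC N) : M.hcUnitary N a b ∈ polyTimeComputableComplex := by
  rcases subsingleton_or_nontrivial M.Γ with hΓ | hΓ
  · rw [hcUnitary_of_subsingleton]
    exact M.entriesIn_hcStep₁ (K := polyTimeComputableSubfield) (M.delta_mem_of_amplitudes_subset h) N a b
  · rw [hcUnitary_of_nontrivial]
    exact M.entriesIn_hcStep (K := polyTimeComputableSubfield) conj_mem_polyTimeComputableSubfield
      (M.delta_mem_of_amplitudes_subset h) N a b

end polytime

end QTM

end Literature.Computability.Cryptography

end
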